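import Literature.NumberTheory.Sieve.AsymptoticSieveForPrimesRoughBilinear
import HarnessLib

/-!
# Asymptotic sieve for primes under (B*) with an implied constant: the reduced sieved bilinear bound

Topic `Literature/NumberTheory/Sieve` (trunk T-SIEVE), a sequel of
`Literature.NumberTheory.Sieve.AsymptoticSieveForPrimesRoughBilinear`. Source: J. Friedlander,
H. Iwaniec, *Asymptotic sieve for primes*, Ann. of Math. 148 (1998) 1041–1065
[FriedlanderIwaniecASP1998] (= arXiv:math/9811186), §10 p. 1063 (B*) and p. 1065, §2 (B′)
pp. 1046–1048, and §9 pp. 1060–1063 (proof of Theorem 2).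

## Why this file exists

The tree's hypothesis bundle `SieveSequence.FIAsymptoticSieveHypothesesRough` demands the sieved
bilinear bound (B*) with the EXPLICIT constant `1`,
`∑_m |∑*_{N<n≤2N, mn≤x} γ(n,C) μ(mn) a_{mn}| ≤ A(x)(log x)^{-2^{26}}`, where the print (p. 1063) has
"`≪ A(x)(log x)^{-2^{26}}`". For FI's Theorem 2/3 (§9: sequences not supported on squarefree
numbers, reduced to Theorem 1 through `ã_n = μ²(n) a_n`) the implied constant is indispensable: the
bilinear forms of `a` and `ã` coincide while `Ã(x) = G A(x)(1 + O(1/log x))` with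
`G = ∏_p (1 - g(p²)) < 1` in general ((9.8), (9.12)), so (B*) for `A` normalised by `A(x)` yields
(B*) for `Ã` normalised by `Ã(x)` only up to the factor `G⁻¹` ("we saved at least a factor `log x`
which is needed for clearing the implied constants", p. 1062, applies to (R), not to (B*)). This
file starts the variant of the (B*)-pipeline (`…RoughBilinear` → `…S3Rough` → `…S2Rough` →
`…RoughAssembly`) in which (B*) carries an arbitrary constant `K`:

* `SieveSequence.FIAsymptoticSieveHypothesesCore.reduced_rough_bilinear_bound_six_of_bilinear` —
  the reduced sieved bilinear bound with the weight `6^{ω(m)}` and saving `(log x)^{-k}`,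
  `k ≤ 2^{18}`, from the core clauses and (B*) with a constant `K` (the proof of
  `FIAsymptoticSieveHypothesesRough.reduced_rough_bilinear_bound_six` verbatim, the constant being
  cleared by one power of `log x`: `K (log x)^{-2^{26}} ≤ (log x)^{-2^{22}}` once `log x ≥ K`);
* `SieveSequence.FIAsymptoticSieveHypothesesRough.bilinear_const` — the constant-`1` bundle gives
  the constant-`K` clause with `K = 1` (so every consumer of the new lemma covers the old one).

No definition is introduced (the (B*)-with-constant clause is spelled out in each statement).

## References

* J. Friedlander, H. Iwaniec, *Asymptotic sieve for primes*, Ann. of Math. 148 (1998), 1041–1065,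
  §10 (B*) p. 1063 and p. 1065; §2 (B′). [cite: FriedlanderIwaniecASP1998, §10 (B*) and p. 1065]

## Mathlib / tree search

Tree: `fiBilinearRough`, `FIAsymptoticSieveHypothesesCore(.withTrivialBilinear)`,
`FIAsymptoticSieveHypothesesRough(.bilinear)` (`…Rough`); `SieveSequence.sum_six_pow_mul_le_holder`,
`sum_divisorsAntidiagonal_eleven_pow_mul_card_divisors_le` (`…RoughBilinear`); `holder_tail_le_pow`
(`…BilinearStrong`); `FIAsymptoticSieveHypotheses.sum_a_mul_card_divisors_pow_four_le`,
`sum_sum_le_sum_divisorsAntidiagonal` (`…Reduction`). `lean search 'RoughK|of_bilinear\b'`: nothing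
before this file.
-/

noncomputable section

open Filter Finset
open scoped ArithmeticFunction.Moebius ArithmeticFunction.sigma ArithmeticFunction.omega

namespace Literature.NumberTheory.Sieve

variable {A : SieveSequence} {D δ Δ P : ℝ → ℝ}

/-- The constant-`1` clause (B*) of `FIAsymptoticSieveHypothesesRough` in the form "with a constant
`K`", `K = 1`. [cite: FriedlanderIwaniecASP1998, §10 (B*)] -/
theorem SieveSequence.FIAsymptoticSieveHypothesesRough.bilinear_const
    (h : A.FIAsymptoticSieveHypothesesRough D δ Δ P) :
    ∀ᶠ x : ℝ in atTop, ∀ N : ℝ, Real.sqrt (D x) / Δ x < N → N < Real.sqrt x / δ x →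
      ∀ C : ℝ, 1 ≤ C → C ≤ x / D x →
        A.fiBilinearRough x N C (P x) ≤ (1 : ℝ) * A.size x / Real.log x ^ (2 ^ 26 : ℕ) := by
  filter_upwards [h.bilinear] with x hx N hN1 hN2 C hC1 hC2
  rw [one_mul]
  exact hx N hN1 hN2 C hC1 hC2

/-- **(B*) with an implied constant, reduced, with the weight `6^{ω(m)}` and the saving
`(log x)^{-k}`, `k ≤ 2^{18}`** (FI §10 p. 1065: "By the argument that gave (B) ⟹ (B′) it follows
that (B*) implies `∑_m τ₃(m)|∑*_{N<n≤2N} γ(n)μ(mn)a_{mn}| ≪ A(x)(log x)^{-2^{23}}`", with the print's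
"`≪`" in (B*), p. 1063). Under the core clauses `SieveSequence.FIAsymptoticSieveHypothesesCore A D`
and (B*) in the form `∑_m |∑*…| ≤ K A(x)(log x)^{-2^{26}}` for all large `x`, all `N` with
`Δ⁻¹√D < N < δ⁻¹√x` (B1) and all `1 ≤ C ≤ x/D` (B3): for every `k ≤ 2^{18}` there is `K'` with
`∑_{m ≤ x} 6^{ω(m)} |∑_{N<n≤2N, mn≤x, (n,Π)=1} γ(n;C) μ(mn) a_{mn}| ≤ K' A(x)(log x)^{-k}` in the same
ranges. Proof: that of `FIAsymptoticSieveHypothesesRough.reduced_rough_bilinear_bound_six`, after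
`K (log x)^{-2^{26}} ≤ (log x)^{-2^{22}}` for `log x ≥ max K 1`.
[cite: FriedlanderIwaniecASP1998, §10 p. 1065 and §2 (B′)] -/
theorem SieveSequence.FIAsymptoticSieveHypothesesCore.reduced_rough_bilinear_bound_six_of_bilinear
    (h : A.FIAsymptoticSieveHypothesesCore D) {K : ℝ}
    (hB : ∀ᶠ x : ℝ in atTop, ∀ N : ℝ, Real.sqrt (D x) / Δ x < N → N < Real.sqrt x / δ x →
      ∀ C : ℝ, 1 ≤ C → C ≤ x / D x →
        A.fiBilinearRough x N C (P x) ≤ K * A.size x / Real.log x ^ (2 ^ 26 : ℕ))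
    {k : ℕ} (hk : k ≤ 2 ^ 18) :
    ∃ K' : ℝ, ∀ᶠ x : ℝ in atTop, ∀ N : ℝ, Real.sqrt (D x) / Δ x < N → N < Real.sqrt x / δ x →
      ∀ C : ℝ, 1 ≤ C → C ≤ x / D x →
        ∑ m ∈ Icc 1 ⌊x⌋₊, (6 : ℝ) ^ m.primeFactors.card *
          |∑ n ∈ (Ioc ⌊N⌋₊ ⌊2 * N⌋₊).filter
              (fun n : ℕ => ((m * n : ℕ) : ℝ) ≤ x ∧ ∀ p ∈ n.primeFactors, P x ≤ (p : ℝ)),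
            (SieveSequence.fiGamma C n : ℝ) * (μ (m * n) : ℝ) * A.a (m * n)| ≤
          K' * A.size x / Real.log x ^ k := by
  have hT := h.withTrivialBilinear
  obtain ⟨K₆, h16⟩ := h.2.2.1
  set C₁ : ℝ := 2 ^ 12 * max K₆ 0 * Real.exp (2 ^ 22) with hC₁
  have hC₁0 : 0 ≤ C₁ := by positivity
  refine ⟨C₁ + 1, ?_⟩
  filter_upwards [h16, hB, eventually_ge_atTop (8 : ℝ), eventually_ge_atTop (Real.exp (max K 1))]
    with x h16x hBx hx8 hxK N hN1 hN2 C hC1 hC2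
  classical
  -- basics at `x`
  have hx1 : (1 : ℝ) < x := by linarith
  have hx0 : (0 : ℝ) < x := by linarith
  set L : ℝ := Real.log x with hLdef
  have hLK : max K 1 ≤ L := by
    rw [hLdef, ← Real.log_exp (max K 1)]
    exact Real.log_le_log (Real.exp_pos _) hxK
  have hL1 : 1 ≤ L := le_trans (le_max_right K 1) hLK
  have hKL : K ≤ L := le_trans (le_max_left K 1) hLK
  have hL0 : 0 < L := by linarith
  have hA0 : 0 ≤ A.size x := by rw [hT.size_eq]; exact A.congrSum_nonneg 1 x
  set M := Icc 1 ⌊x⌋₊ with hMdef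
  set F : ℕ → Finset ℕ := fun m => (Ioc ⌊N⌋₊ ⌊2 * N⌋₊).filter
    (fun n : ℕ => ((m * n : ℕ) : ℝ) ≤ x ∧ ∀ p ∈ n.primeFactors, P x ≤ (p : ℝ)) with hFdef
  set I : ℕ → ℝ := fun m =>
    ∑ n ∈ F m, (SieveSequence.fiGamma C n : ℝ) * (μ (m * n) : ℝ) * A.a (m * n) with hIdef
  -- (B*) with the constant `K`: `R₀ ≤ K A (log x)^{-2^26} ≤ A (log x)^{-2^22}` as `log x ≥ K`
  have hB0 : ∑ m ∈ M, |I m| ≤ A.size x * L ^ (-(2 ^ 22 : ℝ)) := by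
    have h0 := hBx N hN1 hN2 C hC1 hC2
    rw [SieveSequence.fiBilinearRough] at h0
    refine h0.trans ?_
    rw [Real.rpow_neg hL0.le, ← div_eq_mul_inv]
    -- `K A / L^{2^26} ≤ A / L^{2^22}`
    have hpow : L ^ (2 ^ 22 : ℝ) * K ≤ L ^ (2 ^ 26 : ℕ) := by
      calc L ^ (2 ^ 22 : ℝ) * K ≤ L ^ (2 ^ 22 : ℝ) * L :=
            mul_le_mul_of_nonneg_left hKL (Real.rpow_nonneg hL0.le _)
        _ = L ^ (2 ^ 22 + 1 : ℕ) := by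
            rw [show (2 : ℝ) ^ 22 = ((2 ^ 22 : ℕ) : ℝ) by norm_num, Real.rpow_natCast, ← pow_succ]
        _ ≤ L ^ (2 ^ 26 : ℕ) := pow_le_pow_right₀ hL1 (by norm_num)
    have hL22 : 0 < L ^ (2 ^ 22 : ℝ) := Real.rpow_pos_of_pos hL0 _
    have hL26 : 0 < L ^ (2 ^ 26 : ℕ) := pow_pos hL0 _
    rw [div_le_div_iff₀ hL26 hL22]
    calc K * A.size x * L ^ (2 ^ 22 : ℝ) = A.size x * (L ^ (2 ^ 22 : ℝ) * K) := by ring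
      _ ≤ A.size x * L ^ (2 ^ 26 : ℕ) := mul_le_mul_of_nonneg_left hpow hA0
  -- `R₁`
  have hR1' : ∑ m ∈ M, (11 : ℝ) ^ m.primeFactors.card * |I m| ≤ C₁ * A.size x * L ^ (2 ^ 20 : ℝ) := by
    have hIle : ∀ m, |I m| ≤ ∑ n ∈ F m, ((n.divisors.card : ℝ)) * A.a (m * n) := by
      intro m
      refine (Finset.abs_sum_le_sum_abs _ _).trans (Finset.sum_le_sum fun n _ => ?_)
      rw [abs_mul, abs_mul, abs_of_nonneg (A.a_nonneg _)]
      have hγ : |(SieveSequence.fiGamma C n : ℝ)| ≤ (n.divisors.card : ℝ) := by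
        have := SieveSequence.abs_fiGamma_le C n
        rw [ArithmeticFunction.sigma_zero_apply] at this
        exact_mod_cast this
      have hμ : |(μ (m * n) : ℝ)| ≤ 1 := by exact_mod_cast ArithmeticFunction.abs_moebius_le_one
      calc |(SieveSequence.fiGamma C n : ℝ)| * |(μ (m * n) : ℝ)| * A.a (m * n)
          ≤ (n.divisors.card : ℝ) * 1 * A.a (m * n) := by gcongr; exact A.a_nonneg _
        _ = (n.divisors.card : ℝ) * A.a (m * n) := by ring
    calc ∑ m ∈ M, (11 : ℝ) ^ m.primeFactors.card * |I m|
        ≤ ∑ m ∈ M, ∑ n ∈ F m, (11 : ℝ) ^ m.primeFactors.card * ((n.divisors.card : ℝ)) * A.a (m * n) := by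
          refine Finset.sum_le_sum fun m _ => ?_
          rw [show ∑ n ∈ F m, (11 : ℝ) ^ m.primeFactors.card * ((n.divisors.card : ℝ)) * A.a (m * n) =
            (11 : ℝ) ^ m.primeFactors.card * ∑ n ∈ F m, ((n.divisors.card : ℝ)) * A.a (m * n) by
            rw [Finset.mul_sum]; refine Finset.sum_congr rfl fun n _ => by ring]
          exact mul_le_mul_of_nonneg_left (hIle m) (by positivity)
      _ ≤ ∑ k ∈ Ioc 0 ⌊x⌋₊, ∑ p ∈ k.divisorsAntidiagonal,
            (11 : ℝ) ^ p.1.primeFactors.card * ((p.2.divisors.card : ℝ)) * A.a (p.1 * p.2) := by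
          refine sum_sum_le_sum_divisorsAntidiagonal (f := fun m n =>
            (11 : ℝ) ^ m.primeFactors.card * ((n.divisors.card : ℝ)) * A.a (m * n))
            (fun m n => mul_nonneg (by positivity) (A.a_nonneg _)) ⌊x⌋₊ M F fun m hm n hn => ?_
          obtain ⟨hm1, -⟩ := Finset.mem_Icc.mp hm
          obtain ⟨hn1, hn2⟩ := Finset.mem_filter.mp hn
          refine ⟨hm1, Nat.succ_le_of_lt (lt_of_le_of_lt (Nat.zero_le _) (Finset.mem_Ioc.mp hn1).1), ?_⟩
          exact Nat.le_floor hn2.1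
      _ = ∑ k ∈ Ioc 0 ⌊x⌋₊, A.a k * ∑ p ∈ k.divisorsAntidiagonal,
            (11 : ℝ) ^ p.1.primeFactors.card * ((p.2.divisors.card : ℝ)) := by
          refine Finset.sum_congr rfl fun k _ => ?_
          rw [Finset.mul_sum]
          refine Finset.sum_congr rfl fun p hp => ?_
          rw [(Nat.mem_divisorsAntidiagonal.mp hp).1]
          ring
      _ ≤ ∑ k ∈ Ioc 0 ⌊x⌋₊, A.a k * ((k.divisors.card : ℝ)) ^ 4 := by
          refine Finset.sum_le_sum fun k _ => ?_
          by_cases hsq : Squarefree k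
          · exact mul_le_mul_of_nonneg_left
              (sum_divisorsAntidiagonal_eleven_pow_mul_card_divisors_le hsq) (A.a_nonneg k)
          · rw [hT.a_eq_zero hsq, zero_mul, zero_mul]
      _ ≤ C₁ * A.size x * L ^ (2 ^ 20 : ℝ) := hT.sum_a_mul_card_divisors_pow_four_le hx8 h16x
  -- Hölder and the numerical tail
  have hH := SieveSequence.sum_six_pow_mul_le_holder M (r := fun m => |I m|)
    (fun m _ => abs_nonneg _)
  refine hH.trans ?_
  exact holder_tail_le_pow hk hA0 hL1 hC₁0 (Finset.sum_nonneg fun m _ => abs_nonneg _)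
    (Finset.sum_nonneg fun m _ => mul_nonneg (by positivity) (abs_nonneg _)) hB0 hR1'

end Literature.NumberTheory.Sieve
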